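import Summits.QuantumFields.YangMills.Theorems.SwapVirialDeficitSectorLaplaceEndHubHubCot
import Summits.QuantumFields.YangMills.Theorems.SwapVirialDeficitSectorStiffnessCore
import HarnessLib

/-!
# Route `SwapVirialDeficit` (YangMills): THE TIP HUBS IN THE HUB-POLAR LETTER `δ = re a∕‖im a‖` — the left side of `stub_core_tip` of skeleton ➎ as a window integral
# (cell ym-idea-1, brick (T5)(a) of w2 g60's tip memo; the twin of LEAD g99's ✓`…SectorLaplaceEndHubHubCot` for `TipHub τ = {sin²ψ < τ}` = `{(1+δ²)⁻¹ < τ}`;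
# free-hands support of ⟨stmt-QuantumFields-24197⟩ `SwapVirialDeficit.SwapGluedStiffness`)

* §1 `mem_tipHub_prod_iff_cot` (`im a ≠ 0`: `(a, η) ∈ TipHub τ ×ˢ univ ↔ (1+δ²)⁻¹ < τ`), `measurableSet_tipWindow`, `measurableSet_tipHub_prod`;
* §2 ★★ `setLIntegral_tipHub_eq_hubCot` — `∫⁻_{TipHub τ ×ˢ univ} g(F̂(a,ε,η)) d(chartMeasure) = coneConst·π·∫⁻_{{(1+δ²)⁻¹ < τ}} g(F̂(hubAt δ 1, ε, η)) dμ_B(δ, η)`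
  (`μ_B = vol·((1+δ²)⁻¹)²·gnoDensity`, both tips `δ → ±∞` at once), ★ `setIntegral_tipHub_exp_eq_hubCot` (the weight `e^{−bF̂}`).
In the letter `δ` the tip slab `{(1+δ²)⁻¹ < τ}` = `{δ² > τ⁻¹ − 1}` has `μ_B`-hub-mass `≍ ∫_{|δ|>τ^{−1∕2}} δ⁻⁴ ≍ τ^{3∕2}`, against which the Morse–Bott density grows like
`1∕sin²ψ = 1 + δ²` (one soft pair): the weight is flat in `ψ`, `≍ √τ` — the starting point of the tip ∕ shell comparison.

HONEST LABEL: measure bookkeeping; `stub_core_tip`, the other stubs, ⟨24197⟩ ∕ ⟨24194⟩ OPEN; own crux ⟨22884⟩ `LargeFieldMassRefinementTail` OPEN (blocked-on ⟨19935⟩);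
the Yang–Mills mass gap is NOT proved; no summit is proved by a line.  THEOREMS ONLY (0 `def`, 0 `sorry`), standard axioms; the route's local `ℍ` measurability instances
(as in every `…HubCot` file).  Width seat ym-line-sfw-p2-w2 g60 (cell ym-idea-1, free hands), `--supports stmt-QuantumFields-24197`.  References: [folklore].
-/

set_option autoImplicit false
set_option synthInstance.maxSize 1024

noncomputable section

open MeasureTheory Quaternion Set
open scoped Quaternion ENNReal BigOperators
open Literature.MathematicalPhysics.QuantumLattice
open Literature.MathematicalPhysics.QuantumFieldTheory hiding SU2
open Summit.QuantumFields.YangMills.Theorems.SwapTwistDeficit.ToronLog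

attribute [local instance] Literature.Analysis.FluidPDE.Tao2016.quatMeasurableSpace
  Literature.Analysis.FluidPDE.Tao2016.quatBorelSpace
  Literature.MathematicalPhysics.QuantumLattice.secondCountableTopology_su2

namespace Summit.QuantumFields.YangMills.Theorems.SwapVirialDeficit.BlowUpRing

open Summit.QuantumFields.YangMills.Theorems.FemtoTransferGap
open Summit.QuantumFields.YangMills.Theorems.FemtoTransferGap.TT
open Summit.QuantumFields.YangMills.Theorems.VirialFluxGap.RingDeficit
open Summit.QuantumFields.YangMills.Theorems.SwapVirialDeficit.SectorLaplace

variable {L : ℕ} [NeZero L]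

/-! ## §1 The tip hubs in the letter `δ` -/

omit [NeZero L] in
/-- ★ **THE TIP HUBS IN THE LETTER `δ = re a∕‖im a‖`**: for `im a ≠ 0`, `(a, η) ∈ TipHub τ ×ˢ univ ↔ (1+δ²)⁻¹ < τ` (both ends `δ → ±∞`). [folklore] -/
theorem mem_tipHub_prod_iff_cot {a : ℍ} (him : a.im ≠ 0) (η : GnoCoord L) (τ : ℝ) :
    (a, η) ∈ TipHub τ ×ˢ (univ : Set (GnoCoord L)) ↔ (1 + (a.re / ‖a.im‖) ^ 2)⁻¹ < τ := by
  simp only [mem_prod, mem_univ, and_true, TipHub, mem_setOf_eq]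
  rw [hubS2_eq_cot him]

omit [NeZero L] in
/-- The tip window `{(δ, η) | (1+δ²)⁻¹ < τ}` is measurable. [folklore] -/
theorem measurableSet_tipWindow (τ : ℝ) : MeasurableSet {p : ℝ × GnoCoord L | (1 + p.1 ^ 2)⁻¹ < τ} := by
  have hb : Measurable fun p : ℝ × GnoCoord L => (1 + p.1 ^ 2)⁻¹ := (measurable_const.add (measurable_fst.pow_const 2)).inv
  exact measurableSet_lt hb measurable_const

omit [NeZero L] in
/-- `TipHub τ ×ˢ univ` is measurable. [folklore] -/
theorem measurableSet_tipHub_prod (τ : ℝ) : MeasurableSet (TipHub τ ×ˢ (univ : Set (GnoCoord L))) :=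
  (measurableSet_tipHub τ).prod MeasurableSet.univ

/-! ## §2 The tip-hub integrals as window integrals against `μ_B` -/

/-- ★★ **THE TIP-HUB INTEGRALS IN THE LETTERS `(δ, η)`**: for every measurable `g : ℝ → ℝ≥0∞`, sector `z`, character `χ`, signs `ε` and cut `τ`,
`∫⁻_{TipHub τ ×ˢ univ} g(F̂(a, ε, η)) d(chartMeasure) = coneConst·π · ∫⁻_{{(1+δ²)⁻¹ < τ}} g(F̂(hubAt δ 1, ε, η)) dμ_B(δ, η)`. [folklore] -/
theorem setLIntegral_tipHub_eq_hubCot (z : Fin 3 → Bool) (χ : Site 3 L → SU2) (ε : GnoSign L) (τ : ℝ) (g : ℝ → ℝ≥0∞) (hg : Measurable g) :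
    ∫⁻ x in TipHub τ ×ˢ (univ : Set (GnoCoord L)), g (gnoDeficit z χ x.1 ε x.2) ∂(chartMeasure L) =
      ENNReal.ofReal (coneConst * Real.pi) *
        ∫⁻ p in {p : ℝ × GnoCoord L | (1 + p.1 ^ 2)⁻¹ < τ}, g (gnoDeficit z χ (hubAt p.1 1) ε p.2)
          ∂((volume : Measure (ℝ × GnoCoord L)).withDensity fun p => ENNReal.ofReal (((1 + p.1 ^ 2)⁻¹) ^ 2 * gnoDensity p.2)) := by
  set Rg : Set (ℝ × GnoCoord L) := {p : ℝ × GnoCoord L | (1 + p.1 ^ 2)⁻¹ < τ} with hRg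
  have hRgm : MeasurableSet Rg := measurableSet_tipWindow τ
  set H : ℝ × GnoCoord L → ℝ≥0∞ := Rg.indicator fun p => g (gnoDeficit z χ (hubAt p.1 1) ε p.2) with hHdef
  have hHm : Measurable H := (hg.comp (measurable_bDeficit z χ ε)).indicator hRgm
  rw [← lintegral_indicator (measurableSet_tipHub_prod τ), ← lintegral_indicator hRgm]
  have hae : (fun x : ℍ × GnoCoord L => (TipHub τ ×ˢ (univ : Set (GnoCoord L))).indicator (fun x => g (gnoDeficit z χ x.1 ε x.2)) x) =ᵐ[chartMeasure L]
      fun x : ℍ × GnoCoord L => H (x.1.re / ‖x.1.im‖, x.2) := by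
    filter_upwards [ae_im_ne_zero_chartMeasure (L := L)] with x him
    have hmem : x ∈ TipHub τ ×ˢ (univ : Set (GnoCoord L)) ↔ (x.1.re / ‖x.1.im‖, x.2) ∈ Rg := by
      rw [hRg, show x = (x.1, x.2) from rfl, mem_tipHub_prod_iff_cot him]
      simp only [mem_setOf_eq]
    by_cases hx : x ∈ TipHub τ ×ˢ (univ : Set (GnoCoord L))
    · rw [indicator_of_mem hx, hHdef, indicator_of_mem (hmem.1 hx), gnoDeficit_eq_hubCot z χ him]
    · rw [indicator_of_notMem hx, hHdef, indicator_of_notMem (fun h => hx (hmem.2 h))]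
  rw [lintegral_congr_ae hae, lintegral_chartMeasure_hubCot_muB H hHm]

/-- ★ **THE TIP-HUB WEIGHT IN THE LETTERS `(δ, η)`** (the left side of `stub_core_tip`, per sign pattern):
`∫_{TipHub τ ×ˢ univ} e^{−bF̂(a,ε,η)} d(chartMeasure) = coneConst·π · ∫_{{(1+δ²)⁻¹ < τ}} e^{−bF̂(hubAt δ 1, ε, η)} dμ_B`. [folklore] -/
theorem setIntegral_tipHub_exp_eq_hubCot (z : Fin 3 → Bool) (χ : Site 3 L → SU2) (ε : GnoSign L) (τ b : ℝ) :
    ∫ x in TipHub τ ×ˢ (univ : Set (GnoCoord L)), Real.exp (-(b * gnoDeficit z χ x.1 ε x.2)) ∂(chartMeasure L) =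
      coneConst * Real.pi *
        ∫ p in {p : ℝ × GnoCoord L | (1 + p.1 ^ 2)⁻¹ < τ}, Real.exp (-(b * gnoDeficit z χ (hubAt p.1 1) ε p.2))
          ∂((volume : Measure (ℝ × GnoCoord L)).withDensity fun p => ENNReal.ofReal (((1 + p.1 ^ 2)⁻¹) ^ 2 * gnoDensity p.2)) := by
  have hm1 : Measurable fun x : ℍ × GnoCoord L => Real.exp (-(b * gnoDeficit z χ x.1 ε x.2)) :=
    ((measurable_gnoDeficit_uncurry z χ ε).const_mul b).neg.exp
  have hm2 : Measurable fun p : ℝ × GnoCoord L => Real.exp (-(b * gnoDeficit z χ (hubAt p.1 1) ε p.2)) :=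
    ((measurable_bDeficit z χ ε).const_mul b).neg.exp
  rw [integral_eq_lintegral_of_nonneg_ae (Filter.Eventually.of_forall fun x => (Real.exp_pos _).le) hm1.aestronglyMeasurable.restrict,
    integral_eq_lintegral_of_nonneg_ae (Filter.Eventually.of_forall fun x => (Real.exp_pos _).le) hm2.aestronglyMeasurable.restrict]
  have h := setLIntegral_tipHub_eq_hubCot z χ ε τ (fun t => ENNReal.ofReal (Real.exp (-(b * t)))) (by fun_prop)
  rw [h, ENNReal.toReal_mul, ENNReal.toReal_ofReal (mul_pos coneConst_pos Real.pi_pos).le]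

/-- ★ **THE TIP-HUB WEIGHT AS A CONE INTEGRAL OF THE HUB INTEGRAL**: `∫_{TipHub τ ×ˢ univ} e^{−bF̂} d(chartMeasure) = ∫_{TipHub τ} hubIntegral a ε b dcone`
(Fubini on `chartMeasure = cone ⊗ ρdη`; the integrand is bounded by `1·gnoDensity`, integrable). [folklore] -/
theorem setIntegral_tipHub_exp_eq_cone_hubIntegral (ε : GnoSign L) (τ : ℝ) {b : ℝ} (hb : 0 ≤ b) :
    ∫ x in TipHub τ ×ˢ (univ : Set (GnoCoord L)), Real.exp (-(b * gnoDeficit z₀ (fun _ => 1) x.1 ε x.2)) ∂(chartMeasure L) =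
      ∫ a in TipHub τ, hubIntegral a ε b ∂coneMeasure := by
  rw [setIntegral_chartMeasure_prod_univ (integrable_chart_exp hb ε) (measurableSet_tipHub τ)]
  rfl

end Summit.QuantumFields.YangMills.Theorems.SwapVirialDeficit.BlowUpRing

end
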